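import Literature.MathematicalPhysics.QuantumFieldTheory.Balaban1983to89.B2Eq227CondDelta
import Literature.MathematicalPhysics.QuantumFieldTheory.Balaban1983to89.HiggsCondGaussMoments
import Literature.MathematicalPhysics.QuantumFieldTheory.Balaban1983to89.B2Eq234SecondRepr

/-!
# `Balaban1983to89.B2Eq246ScalarStep` — T. Bałaban, *(Higgs)₂,₃ quantum fields in a finite volume. II. An upper bound*,
Commun. Math. Phys. **86** (1982) 555–594 [Balaban1982Higgs2] p. 567: **(2.45) → (2.46)**, *"Another representation is obtained
by calculation of a conditional integral in (2.45) with the conditioning on Λ₅^{(k−1)c}"* — the SCALAR-FIELD FACTOR of that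
conditional integration at a GENERAL step `k`, PROVED ON THE CONCRETE (Higgs)₂,₃ CARRIER: integrating the fluctuation field
`φ′↾_{Λ₅}` out of `t^{L^{k−1}ε}_{a,L,A}(φ, φ′)·exp(−½⟨φ′, Δ^{(k−1),L^{k−1}ε}(Ω,A)φ′⟩)·G(Λ₅ᶜφ′)` produces exactly the printed
terms 7–10 of the exponential in (2.46), the restricted kernel `t(Λ₅ᶜ; φ, φ′)` and the Gaussian factor
`Z^{(k−1),L^{k−1}ε}_{Λ₅}(Ω, A)` of (2.52)

statement-level skeleton of published theorems with citation tags; proofs where landed; nothing here is a claim about the Yang–Mills mass gap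

PDFs held: `paper:balaban1982-cmp86-higgs23-ii` (journal page = PDF page + 554), pp. 562–569 [PDF 8–15];
`paper:balaban1982-cmp85-higgs23-i` (journal page = PDF page + 602), pp. 608–611 [PDF 6–9] — read AS IMAGES on the ×2 renders
`run/shared/lean/pub/pub-balaban/b2b-balaban-ref1/pages/1982-cmp86-higgs23-II/1982-cmp86-higgs23-II-p008…p015-x2.png`,
`…/1982-cmp85-higgs23-I/1982-cmp85-higgs23-I-p006…p009-x2.png`.

CITATION HEADER (lean-in-tree rule).  lit-balaban typed skeleton (HOME `run/shared/lean/pub/lit-balaban/`), typer line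
(concrete carriers), gen 5, file B of the (2.45)→(2.46) pair (file A `B2Eq227CondDelta`: the new quadratic form (2.27)
`Δ^{(k)}_{Λ₅}` at general level).  SKELETON row served: **B2.Eq2.44** ((2.44)–(2.52); the typer cells (2.45)/(2.46) reserved in
ROWS-B2 v2.21 by the fold owner r02; second reader r14: *"those D-rows stay unclaimed on my side"*), members (2.45)/(2.46)
(the conditional-integration STEP between them, scalar factor) and (2.52).  NOTHING of record is restated: the analytic
identity IS p15's (2.34) model theorem `B2Eq234SecondRepr.secondRepr` (Fubini, completion of the square, translation of
`dφ′↾_Λ`) with its exponents `B2Eq234Exponent.firstExp/secondExp` — INSTANTIATED here; the matrices are p35's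
`B1Eq230FluctCov.mat` in p34's coordinates `B1Eq221Coordinates.fieldCoord`; the operators ARE p35's `avgQLin/avgQAdjLin`
(I (2.7)), `deltaKA` (I (2.17)/(2.21)), `precOpA` (I (2.30)), the typer's `condCov232` (I (2.32)), `formMat`/`fieldOfCrd`
(`HiggsCondGauss228`), `condDelta227` (II (2.27), file A), the kernel `HiggsAveraging.rtKernelStep` = b2b's `B1RT.blockKernel`.
THE SOURCE TEXT, p. 567 [PDF 13], verbatim (scalar-field lines; `A_{k−1} = A′`, `φ_{k−1} = φ′`):
*"ρ″^{(k),L^kε}(Λ₀^{(0)}, …, Λ₀^{(k−1)}, A, θ_kA^{(k),ε}, φ) = χ_k T^{L^{k−1}ε}_{a,L}[T^{L^{k−1}ε}_{a,L,Ã}[ζ_{Λ₀^{(k−1)}}χ_{Λ₋₁^{(k−1)}∩Λ₅^{(k−1)c}}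
χ_{k−1,Λ₅^{(k−1)c}} · ρ′^{(k−1),L^{k−1}ε}(…, A′, Ã′, φ′) · exp[… − ½⟨Λ₃^{(k−1)}φ′, Δ^{(k−1),L^{k−1}ε}(B^{k−1}(Λ₂^{(k−1)}),
A^{(k),ε})Λ₃^{(k−1)}φ′⟩]]], (2.45) where Ã = (1 − θ_k)θ_{k−1}A^{(k−1),ε} + θ_kA^{(k),ε} … Another representation is obtained
by calculation of a conditional integral in (2.45) with the conditioning on Λ₅^{(k−1)c}:
ρ″^{(k),L^kε}(…) = χ_k∫dA′↾_{Λ₅^{(k−1)c}}∫dφ′↾_{Λ₅^{(k−1)c}} t^{L^{k−1}ε}_{a,L}(Λ₅^{(k−1)c}; A, A′) t^{L^{k−1}ε}_{a,L,Ã}(Λ₅^{(k−1)c}; φ, φ′)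
· ζχχ ρ′^{(k−1),L^{k−1}ε}(…) · exp[… − ½⟨(Λ₃^{(k−1)}∩Λ₅^{(k−1)c})φ′, Δ^{(k−1),L^{k−1}ε}(B^{k−1}(Λ₂^{(k−1)}), A^{(k),ε})(Λ₃^{(k−1)}∩Λ₅^{(k−1)c})φ′⟩
+ ½⟨(Λ₃^{(k−1)}∩Λ₅^{(k−1)c})φ′, Δ^{(k−1),L^{k−1}ε}(B^{k−1}(Λ₂^{(k−1)}), A^{(k),ε}) C^{(k−1),L^{k−1}ε}_{Λ₅^{(k−1)}}(B^{k−1}(Λ₂^{(k−1)}), A^{(k),ε})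
Δ^{(k−1),L^{k−1}ε}(B^{k−1}(Λ₂^{(k−1)}), A^{(k),ε})(Λ₃^{(k−1)}∩Λ₅^{(k−1)c})φ′⟩
− a(L^kε)^{−2}⟨(Λ₃^{(k−1)}∩Λ₅^{(k−1)c})φ′, Δ^{(k−1),L^{k−1}ε}(B^{k−1}(Λ₂^{(k−1)}), A^{(k),ε}) C^{(k−1),L^{k−1}ε}_{Λ₅^{(k−1)}}(B^{k−1}(Λ₂^{(k−1)}), A^{(k),ε})
Q^*(A^{(k),ε})φ⟩ − ½⟨φ, Δ^{(k),L^kε}_{Λ₅^{(k−1)}}(B^{k−1}(Λ₂^{(k−1)}), A^{(k),ε})φ⟩] · Z^{(k−1),L^{k−1}ε}_{Λ₅^{(k−1)}} Z^{(k−1),L^{k−1}ε}_{Λ₅^{(k−1)}}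
(B^{k−1}(Λ₂^{(k−1)}), A^{(k),ε}). (2.46)"*; p. 569 [PDF 15]: *"Z^{(j),L^jε}_{Λ₅^{(j)}}(B^j(Λ₂^{(j)}), Ã^ε) = (a(L^{j+1}ε)^{d−2}/2π)^{(N/2)|Λ₅^{(j)}|}
∫dφ↾_{Λ₅^{(j)}} exp(−½⟨φ, (C^{(j),L^jε}_{Λ₅^{(j)}}(B^j(Λ₂^{(j)}), Ã^ε))^{−1}φ⟩) (2.52)"*; part I p. 608 [PDF 6] (2.5)/(2.6): the kernel
`Π_y (a(L^{k+1}ε)^{d−2}/2π)^{N/2} exp(−½a(L^{k+1}ε)^{d−2}|ψ(y) − (Q(A)φ)(y)|²)`; p. 611 [PDF 9] (2.32).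

DICTIONARY (print ↦ Lean; the step `k − 1 ↦ j`, so the new field `φ` ↦ `ψ : ScalarField P (j+1) N`, the fluctuation field
`φ′` ↦ `φ : ScalarField P j N`, the coefficient `a(L^kε)^{−2}` ↦ `stepCoef P a j`, `Λ₅^{(k−1)}` ↦ `Λ = blockSet Λ′` for a set
`Λ′` of sites of `T^{(j+1)}` (a union of blocks, as I (2.32) requires), `(B^{k−1}(Λ₂^{(k−1)}), A^{(k),ε})` ↦ an arbitrary pair
`(Ω, A)`, the factor `ζχχρ′·exp[the other terms]` — a function of `Λ₅ᶜφ′` (and of the other fields) — ↦ a bounded measurable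
weight `G(Λᶜφ)`; `t_{a,L,A}(φ, φ′)` ↦ `HiggsAveraging.rtKernelStep C a A ψ φ`; `t(Λ₅ᶜ; φ, φ′)` ↦ `rtKernelOut` (the product
(2.5) over the blocks outside `Λ′`); `Z^{(k−1)}_{Λ₅}(Ω, A)` ↦ `zCond252`, with the exponent `(N/2)|Λ₅^{(k−1)}|` read as `N/2`
times the number `|Λ′|` of `L^kε`-lattice points of `Λ₅^{(k−1)}` (one factor `(a(L^kε)^{d−2}/2π)^{N/2}` per block, as in the
kernel (2.5) and in I (3.32) whose exponent counts `T₁^{(k)}`) — the reading under which (2.45) = (2.46)·Z holds EXACTLY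
(`rt_condStep`); the model letters of p15's (2.34) theorem: `S` ↦ the coordinates of the level-`j` fields, `p` ↦ `inSet Λ`,
`T` ↦ the coordinates of the level-`(j+1)` fields, `pT` ↦ `inSet Λ′`, `κ` ↦ `a(L^{j+1}ε)^{d−2}` (`B1RT.prec`), `Qm` ↦ `kerQ`
(the transposed matrix of `Q(A)`; `mat Q^* = L^d·(mat Q)ᵀ`, `mat_avgQAdjLin`), `D` ↦ `matD` (`(L^jε)^d·mat Δ^{(j)}`),
`mainOp κ Qm D` = the typer's `formMat` (`mainOp_eq_formMat`), `st` ↦ all pairs (at `j ≥ 1` the operator `Δ^{(j)}` is not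
of nearest-neighbour type, and (2.46) prints the full bilinear forms, not boundary sums).

WHAT THIS FILE PROVES (0 sorry; standard axioms; definitions with bodies + theorems).
§1 coordinates: `mat_apply`, the support of the kernel of `Q(A)` in the blocks (`blockOf_eq_of_mat_avgQLin_ne_zero`, hence
   p15's «Λ a union of blocks» hypothesis `hQ` for `Λ = blockSet Λ′`: `kerQ_support`), `mat Q^*(A) = L^d·(mat Q(A))ᵀ`
   (`mat_avgQAdjLin`), `mainOp_eq_formMat`; the exterior configuration as a field `fieldOfOut` (supported in `Λᶜ`, measurable).
§2 the exponents: `stepExp245` (= the scalar Gaussian exponent of (2.45): kernel + basic form) and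
   `stepExp246 = outExp + condTerms246` (the exponent of `t(Λ₅ᶜ;φ,φ′)` + the printed terms 7–10 of (2.46), term by term, with
   `Δ^{(k)}_{Λ₅}` = file A's `condDelta227`) — DEFINITIONS WITH BODIES — and the dictionary `firstExp = stepExp245`,
   `secondExp = stepExp246` (`firstExp_eq_stepExp245`, `secondExp_eq_stepExp246`: five printed terms identified one by one).
§3 **THE CONDITIONAL INTEGRATION (2.45) → (2.46), scalar factor** — `condStep246`: for m² > 0, a > 0, L > 1, j ≤ K, every
   `Ω`, `A`, `C`, `Λ′`, `ψ` and every bounded measurable weight `G`,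
   `∫dφ G(Λᶜφ) e^{stepExp245(ψ,φ)} = ∫dφ↾_{Λᶜ} G e^{stepExp246(ψ,·)} · ∫dφ↾_Λ e^{−½⟨φ,(C^{(j)}_Λ)^{−1}φ⟩}` (p15's `secondRepr`,
   every hypothesis discharged), the last factor read through `restrictOp Λ precOpA` = the inverse of `condCov232` on the
   `Λ`-supported fields (`norm_integrand_eq_restrictOp`) and in closed form (`norm252_eq`, p15's `norm234_eq`).
§4 **(2.52)** `zCond252` (DEFINITION WITH BODY) > 0, and the RT-kernel form of §3: `rt_condStep` —
   `∫dφ′ t_{a,L,A}(ψ,φ′) e^{−½⟨φ′,Δ^{(j)}(Ω,A)φ′⟩} G(Λᶜφ′) = ∫dφ′↾_{Λᶜ} t(Λᶜ;ψ,φ′) e^{condTerms246} G · Z^{(j)}_Λ(Ω,A)`.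
HONEST SCOPE.  (a) the basic form is taken on all of `T^{(j)}` — the print restricts it to `Λ₃^{(k−1)} ⊃ Λ₅^{(k−1)}`, which
changes nothing on `Λ₅` (`(Λ₃ΔΛ₃)↾_{Λ₅} = Δ↾_{Λ₅}`) and decorates the exterior field in terms 7–9 as `(Λ₃∩Λ₅ᶜ)φ′` instead of
`Λ₅ᶜφ′`; (b) the regions `Λ_i^{(j)}`, the cut-offs `θ`, `ζ`, the characteristic functions and `ρ′` are not constructed — they
are the weight `G`; «Ã = A^{(k),ε} on B^{k−1}(Λ₂)» (θ_k = 1 there) is why one pair `(Ω, A)` serves kernel and form; (c) the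
vector-field factor (`t_{a,L}(Λ₅ᶜ; A, A′)`, terms 1–4, `Z^{(k−1)}_{Λ₅}`) is the same theorem at `N = d`, coupling `0`
(file A `condDelta227_zero_field`, `HiggsCondGauss228` §5) and is not spelled out; (d) `Λ′` any finite set of sites of
`T^{(j+1)}` (print: unions of big blocks); (e) nothing quantitative ((2.47)/(2.48) are r14's `B2Sect2BDensities`).  Value =
the k-th step conditional integration certified for the concrete objects every later display ((2.47)–(2.53), III (1.16))
starts from; NOT summit progress.  Unit `lit-balaban-typer` gen 5 (literature-prover-lit-balaban-typer-g5-0); HOME/FILED.md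
records the proposal.
-/

open scoped BigOperators InnerProductSpace Matrix
open _root_.MeasureTheory Matrix

namespace Literature.MathematicalPhysics.QuantumFieldTheory.Balaban1983to89.B2Eq246ScalarStep

open HiggsLattice HiggsAveraging HiggsCovariance B1Eq27StepAdjoint B1Eq221Coordinates B1Eq230FluctCov B1Eq230FluctCovPos
  HiggsCondCov232 HiggsCondGauss228 HiggsCondGaussMoments B2Eq255Concrete B2Eq227CondDelta
open HiggsFluctMeasurePos (siteInner_comm siteInner_add_right siteInner_sub_right siteInner_smul_right siteInner_smul_left)
open B2Eq228Conditioning (In Out resIn resOut glue blkIn blkMix blkOut)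
open B2Eq234Exponent (mainOp firstExp secondExp form227 cov bdryQuad bdryLin)

variable {P : HiggsLattice.Params} {N : ℕ}

/-! ## §1 Coordinates: the kernel of `Q(A)`, its block support, `mat Q^* = L^d (mat Q)ᵀ`, `mainOp = formMat` -/

section Coordinates

variable {j : ℕ}

/-- The inverse coordinates, componentwise: `⟪b_i, (fieldCoord⁻¹u)(x)⟫ = u(x, i)`. [cite: Balaban1982Higgs1, p.605] -/
theorem siteCoord_fieldCoord_symm (u : HiggsLattice.Site P j × Ix N → ℝ) (x : HiggsLattice.Site P j) (i : Ix N) :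
    siteCoord (E N) ((fieldCoord (E N) (HiggsLattice.Site P j)).symm u x) i = u (x, i) := by
  have h := fieldCoord_apply (E N) (HiggsLattice.Site P j) ((fieldCoord (E N) (HiggsLattice.Site P j)).symm u) (x, i)
  rw [LinearEquiv.apply_symm_apply] at h
  exact h.symm

/-- The coordinate basis vector `e_{(x,i)}` of p35's `cb` is the field supported at the single site `x`: it vanishes at every
other site. [cite: Balaban1982Higgs1, (1.5) p.604] -/
theorem cb_apply_of_ne (s : HiggsLattice.Site P j × Ix N) {x : HiggsLattice.Site P j} (hx : x ≠ s.1) : (cb P N j) s x = 0 := by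
  rw [cb, Module.Basis.coe_ofEquivFun]
  apply (siteCoord (E N)).injective
  funext i
  rw [siteCoord_fieldCoord_symm, map_zero]
  have hne : (x, i) ≠ s := fun h => hx (by rw [← h])
  rw [Pi.single_eq_of_ne hne]
  rfl

/-- Entries of p35's coordinate matrix: `(mat f)_{t,s} = fieldCoord(f e_s)(t)`. [cite: Balaban1982Higgs1, (1.5) p.604] -/
theorem mat_apply {i j : ℕ} (f : ScalarField P i N →ₗ[ℝ] ScalarField P j N) (t : HiggsLattice.Site P j × Ix N)
    (s : HiggsLattice.Site P i × Ix N) :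
    mat f t s = fieldCoord (E N) (HiggsLattice.Site P j) (f (cb P N i s)) t := by
  rw [mat, LinearMap.toMatrix_apply, cb_repr]

/-- `(Q(A)φ)(y)` depends on `φ↾_{B(y)}` only (I (2.7): the sum runs over `x ∈ B(y)`): a field vanishing on `B(y)` has zero
average at `y`. [cite: Balaban1982Higgs1, (2.7) p.608] -/
theorem avgQLin_apply_eq_zero (C : ChargeData N) (A : HiggsLattice.VecField P 0) (j : ℕ) {φ : ScalarField P j N}
    {y : HiggsLattice.Site P (j + 1)} (h : ∀ x ∈ HiggsLattice.block y, φ x = 0) : avgQLin C A j φ y = 0 := by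
  rw [avgQLin_apply, avgQ_apply, Finset.sum_eq_zero (fun x hx => by rw [h x hx, map_zero]), smul_zero]

/-- **The kernel of `Q(A)` is supported in the blocks**: `(mat Q(A))_{(y,i′),(x,i)} ≠ 0 ⇒ x ∈ B(y)`. [cite: Balaban1982Higgs1, (2.7) p.608] -/
theorem blockOf_eq_of_mat_avgQLin_ne_zero (C : ChargeData N) (A : HiggsLattice.VecField P 0) (j : ℕ)
    {t : HiggsLattice.Site P (j + 1) × Ix N} {s : HiggsLattice.Site P j × Ix N} (h : mat (avgQLin C A j) t s ≠ 0) :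
    HiggsLattice.blockOf s.1 = t.1 := by
  by_contra hne
  apply h
  rw [mat_apply, fieldCoord_apply]
  have h0 : avgQLin C A j ((cb P N j) s) t.1 = 0 := by
    refine avgQLin_apply_eq_zero C A j fun x hx => cb_apply_of_ne s ?_
    have hxt : HiggsLattice.blockOf x = t.1 := by simpa [HiggsLattice.block] using hx
    intro hxs
    exact hne (by rw [← hxs]; exact hxt)
  rw [h0, map_zero]
  rfl

variable (C : ChargeData N) (A : HiggsLattice.VecField P 0)

/-- **The letter `Qm` of p15's (2.34) model for the `j`-th step**: the TRANSPOSED coordinate matrix of `Q(A)` (so that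
`(Qmᵀφ)(t) = (Q(A)φ)(t)` and `Qm·B` is `L^{−d}`-free `Q^*`-shape, cf. `B2Eq234Exponent`'s dictionary «the print's Q^* carries no
L^{−d}»). [cite: Balaban1982Higgs2, (2.34) p.564] -/
noncomputable def kerQ (j : ℕ) : Matrix (HiggsLattice.Site P j × Ix N) (HiggsLattice.Site P (j + 1) × Ix N) ℝ :=
  (mat (avgQLin C A j))ᵀ

/-- **«Λ is a union of blocks» (I (2.32)) ⇒ p15's support hypothesis `hQ`** for `Λ = B(Λ′)`: a non-zero kernel entry
`Qm (x,i) (y,i′)` forces `x ∈ B(y)`, hence `x ∈ B(Λ′) ↔ y ∈ Λ′`. [cite: Balaban1982Higgs1, (2.32) p.611] -/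
theorem kerQ_support (j : ℕ) (Λ' : Finset (HiggsLattice.Site P (j + 1))) (s : HiggsLattice.Site P j × Ix N)
    (t : HiggsLattice.Site P (j + 1) × Ix N) (h : kerQ C A j s t ≠ 0) :
    (inSet N (blockSet Λ') s ↔ inSet N Λ' t) := by
  rw [kerQ, Matrix.transpose_apply] at h
  have hb := blockOf_eq_of_mat_avgQLin_ne_zero C A j h
  show s.1 ∈ blockSet Λ' ↔ t.1 ∈ Λ'
  rw [mem_blockSet, hb]

/-- `(L^{j+1}ε)^d = (L^jε)^d · L^d`. [cite: Balaban1982Higgs1, (1.5) p.604] -/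
theorem mesh_pow_mul_L_pow (j : ℕ) : P.mesh j ^ P.d * (P.L : ℝ) ^ P.d = P.mesh (j + 1) ^ P.d := by
  have hL : ((P.L : ℝ) ^ P.d) ≠ 0 := (pow_pos (by exact_mod_cast P.hL) _).ne'
  rw [← mesh_succ_pow_mul j]
  field_simp

/-- **`mat Q^*(A) = L^d · (mat Q(A))ᵀ`**: the (1.5)-adjoint in coordinates — the weights `(L^{j+1}ε)^d/(L^jε)^d = L^d`
(p35's `adjoint_transfer` of `B1Eq27StepAdjoint.siteInner_avgQLin`). [cite: Balaban1982Higgs1, (1.5) p.604] -/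
theorem mat_avgQAdjLin (j : ℕ) : mat (avgQAdjLin C A j) = ((P.L : ℝ) ^ P.d) • (mat (avgQLin C A j))ᵀ := by
  have hm : P.mesh (j + 1) ^ P.d ≠ 0 := (pow_pos (P.mesh_pos _) _).ne'
  have hL0 : ((P.L : ℝ) ^ P.d) ≠ 0 := (pow_pos (by exact_mod_cast P.hL) _).ne'
  refine Matrix.ext_iff_mulVec.mpr fun ψ => dotProduct_eq _ _ fun φ => ?_
  rw [dotProduct_comm, dotProduct_comm _ φ]
  have h := adjoint_transfer (fun f g => siteInner_avgQLin C A j f g) φ ψ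
  rw [dotProduct_wt_mulVec, dotProduct_wt_mulVec, ← mesh_succ_pow_mul j, mul_assoc] at h
  have h' := mul_left_cancel₀ hm h
  rw [Matrix.smul_mulVec, dotProduct_smul, smul_eq_mul, Matrix.dotProduct_mulVec φ (mat (avgQLin C A j))ᵀ,
    Matrix.vecMul_transpose, ← h', ← mul_assoc, mul_inv_cancel₀ hL0, one_mul]

/-- `(kerQ)ᵀ` acts as `Q(A)`: `(kerQ)ᵀ·fieldCoord φ = fieldCoord(Q(A)φ)`. [cite: Balaban1982Higgs1, (2.7) p.608] -/
theorem kerQ_transpose_mulVec (j : ℕ) (φ : ScalarField P j N) :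
    (kerQ C A j)ᵀ *ᵥ fieldCoord (E N) (HiggsLattice.Site P j) φ = fieldCoord (E N) (HiggsLattice.Site P (j + 1)) (avgQLin C A j φ) := by
  rw [kerQ, Matrix.transpose_transpose, mat_mulVec]

/-- `kerQ` acts as `L^{−d}Q^*(A)`: `kerQ·fieldCoord ψ = L^{−d}·fieldCoord(Q^*(A)ψ)`. [cite: Balaban1982Higgs1, (1.5) p.604] -/
theorem kerQ_mulVec (j : ℕ) (ψ : ScalarField P (j + 1) N) :
    kerQ C A j *ᵥ fieldCoord (E N) (HiggsLattice.Site P (j + 1)) ψ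
      = ((P.L : ℝ) ^ P.d)⁻¹ • fieldCoord (E N) (HiggsLattice.Site P j) (avgQAdjLin C A j ψ) := by
  have hL0 : ((P.L : ℝ) ^ P.d) ≠ 0 := (pow_pos (by exact_mod_cast P.hL) _).ne'
  have h : mat (avgQAdjLin C A j) *ᵥ fieldCoord (E N) (HiggsLattice.Site P (j + 1)) ψ
      = (((P.L : ℝ) ^ P.d) • (mat (avgQLin C A j))ᵀ) *ᵥ fieldCoord (E N) (HiggsLattice.Site P (j + 1)) ψ := by
    rw [mat_avgQAdjLin]
  rw [mat_mulVec, Matrix.smul_mulVec] at h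
  rw [kerQ, h, inv_smul_smul₀ hL0]

variable (Ω : Finset (HiggsLattice.Site P 0)) (msq a : ℝ)

/-- **The letter `D` of p15's (2.34) model for the `j`-th step**: the coordinate matrix of the basic quadratic form
`⟨φ′, Δ^{(j),L^jε}(Ω,A)φ′⟩` for (1.5), `(L^jε)^d · mat Δ^{(j)}`. [cite: Balaban1982Higgs2, (2.45) p.567] -/
noncomputable def matD (j : ℕ) : Matrix (HiggsLattice.Site P j × Ix N) (HiggsLattice.Site P j × Ix N) ℝ :=
  (P.mesh j ^ P.d) • mat (deltaKA C Ω A msq a j)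

/-- `fieldCoord φ · (matD · fieldCoord φ′) = ⟨φ, Δ^{(j)}(Ω,A)φ′⟩`. [cite: Balaban1982Higgs2, (2.45) p.567] -/
theorem dotProduct_matD_mulVec (j : ℕ) (φ φ' : ScalarField P j N) :
    fieldCoord (E N) (HiggsLattice.Site P j) φ ⬝ᵥ (matD C A Ω msq a j *ᵥ fieldCoord (E N) (HiggsLattice.Site P j) φ')
      = siteInner φ (deltaKA C Ω A msq a j φ') := by
  rw [matD, Matrix.smul_mulVec, dotProduct_smul, mat_mulVec, smul_eq_mul, ← siteInner_eq_dotProduct]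

/-- **p15's main operator IS the typer's `formMat`**: `D + κ·QmQmᵀ = (L^jε)^d·mat(a(L^{j+1}ε)^{−2}P(A) + Δ^{(j)}(Ω,A))` with
`κ = a(L^{j+1}ε)^{d−2}` — the *"main quadratic form in the field φ′"* of (2.45) in coordinates. [cite: Balaban1982Higgs2, (2.28) p.563] -/
theorem mainOp_eq_formMat (j : ℕ) :
    mainOp (B1RT.prec a (P.mesh (j + 1)) P.d) (kerQ C A j) (matD C A Ω msq a j) = formMat C Ω A msq a j := by
  have hs : stepCoef P a j * P.mesh (j + 1) ^ P.d = P.mesh j ^ P.d * stepCoef P a j * (P.L : ℝ) ^ P.d := by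
    rw [← mesh_pow_mul_L_pow j]; ring
  rw [mainOp, kerQ, Matrix.transpose_transpose, matD, formMat, precOpA_eq, mat_add, mat_smul, blockProjA, mat_comp,
    mat_avgQAdjLin, Matrix.smul_mul, smul_add, smul_smul, smul_smul, ← stepCoef_mul_mesh_pow, hs, add_comm]

/-! ### The exterior configuration `φ′↾_{Λᶜ}` as a field; measurability -/

/-- **The exterior configuration `y : Λᶜ → R^N` as a field on `T^{(j)}` supported in `Λᶜ`** (inverse coordinates of p15's
`glue 0 y`; the variable of `∫dφ′↾_{Λ₅ᶜ}` in (2.46)). [cite: Balaban1982Higgs2, (2.46) p.567] -/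
noncomputable def fieldOfOut (Λ : Finset (HiggsLattice.Site P j)) (y : Out (inSet (P := P) N Λ) → ℝ) : ScalarField P j N :=
  (fieldCoord (E N) (HiggsLattice.Site P j)).symm (glue (inSet N Λ) 0 y)

/-- `fieldCoord (fieldOfOut Λ y) = glue 0 y`. [cite: Balaban1982Higgs2, (2.46) p.567] -/
theorem fieldCoord_fieldOfOut (Λ : Finset (HiggsLattice.Site P j)) (y : Out (inSet (P := P) N Λ) → ℝ) :
    fieldCoord (E N) (HiggsLattice.Site P j) (fieldOfOut Λ y) = glue (inSet N Λ) 0 y :=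
  LinearEquiv.apply_symm_apply _ _

/-- `(fieldCoord (fieldOfOut Λ y))↾_{Λᶜ} = y`. [cite: Balaban1982Higgs2, (2.46) p.567] -/
theorem resOut_fieldCoord_fieldOfOut (Λ : Finset (HiggsLattice.Site P j)) (y : Out (inSet (P := P) N Λ) → ℝ) :
    resOut (inSet N Λ) (fieldCoord (E N) (HiggsLattice.Site P j) (fieldOfOut Λ y)) = y := by
  rw [fieldCoord_fieldOfOut, B2Eq228Conditioning.resOut_glue]

/-- The field of the exterior coordinates of `φ` is the cut `Λᶜφ`. [cite: Balaban1982Higgs2, (2.46) p.567] -/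
theorem fieldOfOut_resOut (Λ : Finset (HiggsLattice.Site P j)) (φ : ScalarField P j N) :
    fieldOfOut Λ (resOut (inSet N Λ) (fieldCoord (E N) (HiggsLattice.Site P j) φ)) = cutTo Λᶜ φ := by
  apply (fieldCoord (E N) (HiggsLattice.Site P j)).injective
  rw [fieldCoord_fieldOfOut, fieldCoord_cutTo_compl]

/-- `fieldOfOut Λ y` is supported in `Λᶜ`: `Λᶜ(fieldOfOut Λ y) = fieldOfOut Λ y`. [cite: Balaban1982Higgs2, (2.46) p.567] -/
theorem cutTo_compl_fieldOfOut (Λ : Finset (HiggsLattice.Site P j)) (y : Out (inSet (P := P) N Λ) → ℝ) :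
    cutTo Λᶜ (fieldOfOut Λ y) = fieldOfOut Λ y := by
  conv_rhs => rw [← resOut_fieldCoord_fieldOfOut Λ y]
  rw [fieldOfOut_resOut]

/-- Gluing `0` on `Λ` with `y` on `Λᶜ` is measurable in `y`. [folklore] [cite: Balaban1982Higgs2, (2.28) p.563] -/
theorem measurable_glue_zero (Λ : Finset (HiggsLattice.Site P j)) :
    Measurable (fun y : Out (inSet (P := P) N Λ) → ℝ => glue (inSet N Λ) 0 y) := by
  refine measurable_pi_lambda _ fun s => ?_
  by_cases hs : s.1 ∈ Λ
  · have h : (fun y : Out (inSet (P := P) N Λ) → ℝ => glue (inSet N Λ) 0 y s) = fun _ => 0 := by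
      funext y
      simp [glue, inSet, hs]
    rw [h]
    exact measurable_const
  · have h : (fun y : Out (inSet (P := P) N Λ) → ℝ => glue (inSet N Λ) 0 y s) = fun y => y ⟨s, hs⟩ := by
      funext y
      simp [glue, inSet, hs]
    rw [h]
    exact measurable_pi_apply _

/-- `y ↦ fieldOfOut Λ y` is measurable (p34's measurable coordinates). [folklore] [cite: Balaban1982Higgs2, (2.28) p.563] -/
theorem measurable_fieldOfOut (Λ : Finset (HiggsLattice.Site P j)) : Measurable (fieldOfOut (N := N) Λ) := by
  have h : fieldOfOut (N := N) Λ = fun y => (fieldCoordM (E N) (HiggsLattice.Site P j)).symm (glue (inSet N Λ) 0 y) := by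
    funext y
    rw [fieldCoordM_symm_apply]
    rfl
  rw [h]
  exact (fieldCoordM (E N) (HiggsLattice.Site P j)).symm.measurable.comp (measurable_glue_zero Λ)

/-! ### Restricted sums of squares of coordinates = (1.5)-norms of cut fields -/

/-- Coordinates of a cut field: `fieldCoord(Sφ)(x,i) = [x ∈ S]·fieldCoord(φ)(x,i)`. [cite: Balaban1982Higgs1, p.608] -/
theorem fieldCoord_cutTo_apply (S : Finset (HiggsLattice.Site P j)) (u : ScalarField P j N) (t : HiggsLattice.Site P j × Ix N) :
    fieldCoord (E N) (HiggsLattice.Site P j) (cutTo S u) t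
      = if t.1 ∈ S then fieldCoord (E N) (HiggsLattice.Site P j) u t else 0 := by
  simp only [fieldCoord_apply, cutTo]
  split_ifs with h
  · rfl
  · rw [map_zero]
    rfl

/-- `Σ_{(x,i): x∈S} (fieldCoord φ)(x,i)² = (L^jε)^{−d}⟨Sφ, Sφ⟩`. [cite: Balaban1982Higgs1, (1.5) p.604] -/
theorem sum_filter_mem_sq (S : Finset (HiggsLattice.Site P j)) (u : ScalarField P j N) :
    ∑ t ∈ Finset.univ.filter (fun t : HiggsLattice.Site P j × Ix N => inSet N S t),
        (fieldCoord (E N) (HiggsLattice.Site P j) u t) ^ 2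
      = (P.mesh j ^ P.d)⁻¹ * siteInner (cutTo S u) (cutTo S u) := by
  have hm : P.mesh j ^ P.d ≠ 0 := (pow_pos (P.mesh_pos _) _).ne'
  rw [siteInner_eq_dotProduct, ← mul_assoc, inv_mul_cancel₀ hm, one_mul, dotProduct, Finset.sum_filter]
  refine Finset.sum_congr rfl fun t _ => ?_
  rw [fieldCoord_cutTo_apply]
  by_cases h : t.1 ∈ S
  · simp [inSet, h, sq]
  · simp [inSet, h]

/-- `Σ_{(x,i): x∉S} (fieldCoord φ)(x,i)² = (L^jε)^{−d}⟨Sᶜφ, Sᶜφ⟩`. [cite: Balaban1982Higgs1, (1.5) p.604] -/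
theorem sum_filter_not_mem_sq (S : Finset (HiggsLattice.Site P j)) (u : ScalarField P j N) :
    ∑ t ∈ Finset.univ.filter (fun t : HiggsLattice.Site P j × Ix N => ¬ inSet N S t),
        (fieldCoord (E N) (HiggsLattice.Site P j) u t) ^ 2
      = (P.mesh j ^ P.d)⁻¹ * siteInner (cutTo Sᶜ u) (cutTo Sᶜ u) := by
  have hm : P.mesh j ^ P.d ≠ 0 := (pow_pos (P.mesh_pos _) _).ne'
  rw [siteInner_eq_dotProduct, ← mul_assoc, inv_mul_cancel₀ hm, one_mul, dotProduct, Finset.sum_filter]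
  refine Finset.sum_congr rfl fun t _ => ?_
  rw [fieldCoord_cutTo_apply]
  by_cases h : t.1 ∈ S
  · have h' : t.1 ∉ Sᶜ := fun hc => (Finset.mem_compl.mp hc) h
    simp [inSet, h, h']
  · have h' : t.1 ∈ Sᶜ := Finset.mem_compl.mpr h
    simp [inSet, h, h', sq]

end Coordinates

/-! ## §2 The two exponents and the dictionary `firstExp = stepExp245`, `secondExp = stepExp246` -/

section Exponents

variable (C : ChargeData N) (Ω : Finset (HiggsLattice.Site P 0)) (A : HiggsLattice.VecField P 0) (msq a : ℝ)

/-- **The scalar Gaussian exponent of (2.45)** at the `j`-th step: the exponent of the kernel `t^{L^jε}_{a,L,A}(ψ, φ)` of I (2.5)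
plus the basic quadratic form, `−½a(L^{j+1}ε)^{−2}‖ψ − Q(A)φ‖² − ½⟨φ, Δ^{(j),L^jε}(Ω,A)φ⟩` (norms and products of (1.5) at the
levels `j + 1` and `j`). [cite: Balaban1982Higgs2, (2.45) p.567] -/
noncomputable def stepExp245 (j : ℕ) (ψ : ScalarField P (j + 1) N) (φ : ScalarField P j N) : ℝ :=
  -(1 / 2 : ℝ) * stepCoef P a j * siteInner (ψ - avgQLin C A j φ) (ψ - avgQLin C A j φ)
    - (1 / 2 : ℝ) * siteInner φ (deltaKA C Ω A msq a j φ)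

/-- **The exponent of the restricted kernel `t(Λ₅ᶜ; φ, φ′)` of (2.46)** (the product (2.5) over the blocks `y ∉ Λ′`):
`−½a(L^{j+1}ε)^{−2}‖Λ′ᶜ(ψ − Q(A)Λᶜφ)‖²`, `Λ = B(Λ′)`. [cite: Balaban1982Higgs2, (2.46) p.567] -/
noncomputable def outExp (j : ℕ) (Λ' : Finset (HiggsLattice.Site P (j + 1))) (ψ : ScalarField P (j + 1) N)
    (φ : ScalarField P j N) : ℝ :=
  -(1 / 2 : ℝ) * stepCoef P a j *
    siteInner (cutTo Λ'ᶜ (ψ - avgQLin C A j (cutTo (blockSet Λ')ᶜ φ)))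
      (cutTo Λ'ᶜ (ψ - avgQLin C A j (cutTo (blockSet Λ')ᶜ φ)))

/-- **Terms 7–10 of the exponential in (2.46)**, as printed (with `Δ` ↤ `Δ^{(k−1),L^{k−1}ε}(Ω,A)`, `C_Λ` ↤ `C^{(k−1)}_{Λ₅}(Ω,A)`,
`χ` ↤ `Λ₅ᶜφ′`, `a(L^kε)^{−2}` ↤ `stepCoef`, `Δ^{(k)}_{Λ₅}(Ω,A)` ↤ file A's `condDelta227`):
`−½⟨χ, Δχ⟩ + ½⟨χ, ΔC_ΛΔχ⟩ − a(L^kε)^{−2}⟨χ, ΔC_ΛQ^*(A)φ⟩ − ½⟨φ, Δ^{(k)}_{Λ₅}(Ω,A)φ⟩`. [cite: Balaban1982Higgs2, (2.46) p.567] -/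
noncomputable def condTerms246 (j : ℕ) (Λ' : Finset (HiggsLattice.Site P (j + 1))) (ψ : ScalarField P (j + 1) N)
    (φ : ScalarField P j N) : ℝ :=
  -(1 / 2 : ℝ) * siteInner (cutTo (blockSet Λ')ᶜ φ) (deltaKA C Ω A msq a j (cutTo (blockSet Λ')ᶜ φ))
    + (1 / 2 : ℝ) * siteInner (cutTo (blockSet Λ')ᶜ φ)
        (deltaKA C Ω A msq a j
          (condCov232 C Ω A msq a j (blockSet Λ') (deltaKA C Ω A msq a j (cutTo (blockSet Λ')ᶜ φ))))
    - stepCoef P a j * siteInner (cutTo (blockSet Λ')ᶜ φ)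
        (deltaKA C Ω A msq a j (condCov232 C Ω A msq a j (blockSet Λ') (avgQAdjLin C A j ψ)))
    - (1 / 2 : ℝ) * siteInner ψ (condDelta227 C Ω A msq a j Λ' ψ)

/-- **The exponent after the conditional integration** = the exponent of `t(Λ₅ᶜ; φ, φ′)` + terms 7–10 of (2.46); a function
of the exterior field `Λᶜφ′` and of `φ`. [cite: Balaban1982Higgs2, (2.46) p.567] -/
noncomputable def stepExp246 (j : ℕ) (Λ' : Finset (HiggsLattice.Site P (j + 1))) (ψ : ScalarField P (j + 1) N)
    (φ : ScalarField P j N) : ℝ :=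
  outExp C A a j Λ' ψ φ + condTerms246 C Ω A msq a j Λ' ψ φ

variable {j : ℕ}

/-- `e^{stepExp245}` = kernel exponential × basic Gaussian. [cite: Balaban1982Higgs2, (2.45) p.567] -/
theorem exp_stepExp245 (ψ : ScalarField P (j + 1) N) (φ : ScalarField P j N) :
    Real.exp (stepExp245 C Ω A msq a j ψ φ)
      = Real.exp (-(1 / 2 : ℝ) * stepCoef P a j * siteInner (ψ - avgQLin C A j φ) (ψ - avgQLin C A j φ))
          * Real.exp (-(1 / 2 : ℝ) * siteInner φ (deltaKA C Ω A msq a j φ)) := by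
  rw [← Real.exp_add, stepExp245]
  congr 1
  ring

/-- `e^{stepExp246}` = `e^{outExp}` × `e^{condTerms246}`. [cite: Balaban1982Higgs2, (2.46) p.567] -/
theorem exp_stepExp246 (Λ' : Finset (HiggsLattice.Site P (j + 1))) (ψ : ScalarField P (j + 1) N) (φ : ScalarField P j N) :
    Real.exp (stepExp246 C Ω A msq a j Λ' ψ φ)
      = Real.exp (outExp C A a j Λ' ψ φ) * Real.exp (condTerms246 C Ω A msq a j Λ' ψ φ) := by
  rw [← Real.exp_add, stepExp246]

/-- **Dictionary, first exponent**: p15's `firstExp κ Qm D B φ` at the `j`-th step letters IS `stepExp245`.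
[cite: Balaban1982Higgs2, (2.45) p.567] -/
theorem firstExp_eq_stepExp245 (ψ : ScalarField P (j + 1) N) (φ : ScalarField P j N) :
    firstExp (B1RT.prec a (P.mesh (j + 1)) P.d) (kerQ C A j) (matD C A Ω msq a j)
        (fieldCoord (E N) (HiggsLattice.Site P (j + 1)) ψ) (fieldCoord (E N) (HiggsLattice.Site P j) φ)
      = stepExp245 C Ω A msq a j ψ φ := by
  have hm : P.mesh (j + 1) ^ P.d ≠ 0 := (pow_pos (P.mesh_pos _) _).ne'
  have h1 : ∑ t, (fieldCoord (E N) (HiggsLattice.Site P (j + 1)) ψ t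
        - ((kerQ C A j)ᵀ *ᵥ fieldCoord (E N) (HiggsLattice.Site P j) φ) t) ^ 2
      = (P.mesh (j + 1) ^ P.d)⁻¹ * siteInner (ψ - avgQLin C A j φ) (ψ - avgQLin C A j φ) := by
    rw [kerQ_transpose_mulVec, siteInner_eq_dotProduct, ← mul_assoc, inv_mul_cancel₀ hm, one_mul, map_sub, dotProduct]
    exact Finset.sum_congr rfl fun t _ => by rw [Pi.sub_apply, sq]
  rw [firstExp, h1, dotProduct_matD_mulVec, stepExp245, ← stepCoef_mul_mesh_pow]
  field_simp

variable (j)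

/-- The conditional covariance in p15's letters: `cov p (mainOp …) = (L^jε)^{−d}·((mat C^{(j)}_Λ(Ω,A))_Λ)` (the typer's
`inv_blkIn_formMat`). [cite: Balaban1982Higgs1, (2.32) p.611] -/
theorem cov_eq {msq a : ℝ} (hmsq : 0 < msq) (ha : 0 < a) (hL : 1 < (P.L : ℝ)) (hj : j ≤ P.K) (Λ : Finset (HiggsLattice.Site P j)) :
    cov (inSet N Λ) (mainOp (B1RT.prec a (P.mesh (j + 1)) P.d) (kerQ C A j) (matD C A Ω msq a j))
      = (P.mesh j ^ P.d)⁻¹ • blkIn (inSet N Λ) (mat (condCov232 C Ω A msq a j Λ)) := by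
  rw [cov, mainOp_eq_formMat, inv_blkIn_formMat C Ω A hmsq ha hL hj]

/-- The mixed block applied to the exterior configuration: `D_{ΛΛᶜ}y = (L^jε)^d·(fieldCoord(Δ^{(j)}χ))↾_Λ`, `χ = fieldOfOut Λ y`.
[cite: Balaban1982Higgs2, (2.46) p.567] -/
theorem blkMix_matD_mulVec (Λ : Finset (HiggsLattice.Site P j)) (y : Out (inSet (P := P) N Λ) → ℝ) :
    blkMix (inSet N Λ) (matD C A Ω msq a j) *ᵥ y
      = (P.mesh j ^ P.d) • resIn (inSet N Λ) (fieldCoord (E N) (HiggsLattice.Site P j) (deltaKA C Ω A msq a j (fieldOfOut Λ y))) := by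
  rw [← B2Eq228Conditioning.resIn_mulVec_glue_zero, matD, Matrix.smul_mulVec, ← fieldCoord_fieldOfOut, mat_mulVec]
  rfl

/-- Term «t(Λ₅ᶜ)»: `Σ_{t∉Λ′}(B_t − (Qmᵀỹ)_t)² = (L^{j+1}ε)^{−d}‖Λ′ᶜ(ψ − Q(A)χ)‖²`. [cite: Balaban1982Higgs2, (2.46) p.567] -/
theorem outSum_eq (Λ' : Finset (HiggsLattice.Site P (j + 1))) (ψ : ScalarField P (j + 1) N)
    (y : Out (inSet (P := P) N (blockSet Λ')) → ℝ) :
    ∑ t ∈ Finset.univ.filter (fun t => ¬ inSet N Λ' t),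
        (fieldCoord (E N) (HiggsLattice.Site P (j + 1)) ψ t
          - ((kerQ C A j)ᵀ *ᵥ glue (inSet N (blockSet Λ')) 0 y) t) ^ 2
      = (P.mesh (j + 1) ^ P.d)⁻¹ *
          siteInner (cutTo Λ'ᶜ (ψ - avgQLin C A j (fieldOfOut (blockSet Λ') y)))
            (cutTo Λ'ᶜ (ψ - avgQLin C A j (fieldOfOut (blockSet Λ') y))) := by
  rw [← fieldCoord_fieldOfOut, kerQ_transpose_mulVec, ← sum_filter_not_mem_sq, map_sub]
  rfl

/-- Term 7: `y·(D↾_{Λᶜ}y) = ⟨χ, Δ^{(j)}χ⟩` (Dirichlet reading, p15's `quadForm_blkOut`). [cite: Balaban1982Higgs2, (2.46) p.567] -/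
theorem blkOut_form_eq (Λ : Finset (HiggsLattice.Site P j)) (y : Out (inSet (P := P) N Λ) → ℝ) :
    y ⬝ᵥ (blkOut (inSet N Λ) (matD C A Ω msq a j) *ᵥ y)
      = siteInner (fieldOfOut Λ y) (deltaKA C Ω A msq a j (fieldOfOut Λ y)) := by
  rw [B2Eq234Exponent.quadForm_blkOut, ← fieldCoord_fieldOfOut, dotProduct_matD_mulVec]

/-- Term 8: the quadratic boundary sum over ALL pairs is `½⟨χ, ΔC_ΛΔχ⟩`. [cite: Balaban1982Higgs2, (2.46) p.567] -/
theorem bdryQuad_eq {msq a : ℝ} (hmsq : 0 < msq) (ha : 0 < a) (hL : 1 < (P.L : ℝ)) (hj : j ≤ P.K)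
    (Λ : Finset (HiggsLattice.Site P j)) (y : Out (inSet (P := P) N Λ) → ℝ) :
    bdryQuad (inSet N Λ) (cov (inSet N Λ) (mainOp (B1RT.prec a (P.mesh (j + 1)) P.d) (kerQ C A j) (matD C A Ω msq a j)))
        Finset.univ (fun b => -blkMix (inSet N Λ) (matD C A Ω msq a j) b.1 b.2) y
      = (1 / 2 : ℝ) * siteInner (fieldOfOut Λ y)
          (deltaKA C Ω A msq a j (condCov232 C Ω A msq a j Λ (deltaKA C Ω A msq a j (fieldOfOut Λ y)))) := by
  have hm : P.mesh j ^ P.d ≠ 0 := (pow_pos (P.mesh_pos _) _).ne'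
  have hst : ∀ i o, (i, o) ∉ (Finset.univ : Finset (In (inSet (P := P) N Λ) × Out (inSet (P := P) N Λ)))
      → blkMix (inSet N Λ) (matD C A Ω msq a j) i o = 0 := fun i o h => absurd (Finset.mem_univ _) h
  rw [← B2Eq234Exponent.half_quad_blkMix_eq (inSet N Λ) (matD C A Ω msq a j) Finset.univ hst, cov_eq C Ω A j hmsq ha hL hj,
    blkMix_matD_mulVec]
  simp only [Matrix.smul_mulVec, Matrix.mulVec_smul, smul_dotProduct, dotProduct_smul, smul_eq_mul]
  rw [siteInner_deltaKA_comm C Ω A msq a j (fieldOfOut Λ y),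
    siteInner_comm (condCov232 C Ω A msq a j Λ (deltaKA C Ω A msq a j (fieldOfOut Λ y))),
    siteInner_condCov232_eq_blkIn C Ω A msq a Λ (deltaKA C Ω A msq a j (fieldOfOut Λ y))]
  field_simp

/-- Term 9: the linear boundary sum over ALL pairs is `−a(L^{j+1}ε)^{−2}⟨χ, ΔC_ΛQ^*(A)ψ⟩`. [cite: Balaban1982Higgs2, (2.46) p.567] -/
theorem bdryLin_eq {msq a : ℝ} (hmsq : 0 < msq) (ha : 0 < a) (hL : 1 < (P.L : ℝ)) (hj : j ≤ P.K)
    (Λ : Finset (HiggsLattice.Site P j)) (ψ : ScalarField P (j + 1) N) (y : Out (inSet (P := P) N Λ) → ℝ) :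
    bdryLin (inSet N Λ) (cov (inSet N Λ) (mainOp (B1RT.prec a (P.mesh (j + 1)) P.d) (kerQ C A j) (matD C A Ω msq a j)))
        Finset.univ (fun b => -blkMix (inSet N Λ) (matD C A Ω msq a j) b.1 b.2)
        (resIn (inSet N Λ) (B1RT.prec a (P.mesh (j + 1)) P.d • (kerQ C A j *ᵥ fieldCoord (E N) (HiggsLattice.Site P (j + 1)) ψ))) y
      = -(stepCoef P a j) * siteInner (fieldOfOut Λ y)
          (deltaKA C Ω A msq a j (condCov232 C Ω A msq a j Λ (avgQAdjLin C A j ψ))) := by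
  have hm : P.mesh j ^ P.d ≠ 0 := (pow_pos (P.mesh_pos _) _).ne'
  have hL0 : ((P.L : ℝ) ^ P.d) ≠ 0 := (pow_pos (by exact_mod_cast P.hL) _).ne'
  have hst : ∀ i o, (i, o) ∉ (Finset.univ : Finset (In (inSet (P := P) N Λ) × Out (inSet (P := P) N Λ)))
      → blkMix (inSet N Λ) (matD C A Ω msq a j) i o = 0 := fun i o h => absurd (Finset.mem_univ _) h
  have hres : resIn (inSet N Λ) (B1RT.prec a (P.mesh (j + 1)) P.d • (kerQ C A j *ᵥ fieldCoord (E N) (HiggsLattice.Site P (j + 1)) ψ))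
      = (B1RT.prec a (P.mesh (j + 1)) P.d * ((P.L : ℝ) ^ P.d)⁻¹) •
          resIn (inSet N Λ) (fieldCoord (E N) (HiggsLattice.Site P j) (avgQAdjLin C A j ψ)) := by
    rw [kerQ_mulVec, smul_smul]
    rfl
  rw [← B2Eq234Exponent.neg_lin_blkMix_eq (inSet N Λ) (matD C A Ω msq a j) Finset.univ hst, cov_eq C Ω A j hmsq ha hL hj,
    blkMix_matD_mulVec, hres]
  simp only [Matrix.smul_mulVec, Matrix.mulVec_smul, smul_dotProduct, dotProduct_smul, smul_eq_mul]
  rw [siteInner_deltaKA_comm C Ω A msq a j (fieldOfOut Λ y),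
    siteInner_comm (condCov232 C Ω A msq a j Λ (avgQAdjLin C A j ψ)),
    siteInner_condCov232_eq_blkIn₂ C Ω A Λ (deltaKA C Ω A msq a j (fieldOfOut Λ y)) (avgQAdjLin C A j ψ),
    ← stepCoef_mul_mesh_pow, ← mesh_pow_mul_L_pow j]
  field_simp

/-- Term 10: p15's (2.27)-bracket `form227` at the `j`-th step letters IS `⟨ψ, Δ^{(j+1)}_Λ(Ω,A)ψ⟩` of file A.
[cite: Balaban1982Higgs2, (2.27) p.562] -/
theorem form227_eq {msq a : ℝ} (hmsq : 0 < msq) (ha : 0 < a) (hL : 1 < (P.L : ℝ)) (hj : j ≤ P.K)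
    (Λ' : Finset (HiggsLattice.Site P (j + 1))) (ψ : ScalarField P (j + 1) N) :
    form227 (inSet N (blockSet Λ')) (inSet N Λ') (B1RT.prec a (P.mesh (j + 1)) P.d) (kerQ C A j) (matD C A Ω msq a j)
        (fieldCoord (E N) (HiggsLattice.Site P (j + 1)) ψ)
      = siteInner ψ (condDelta227 C Ω A msq a j Λ' ψ) := by
  have hm : P.mesh j ^ P.d ≠ 0 := (pow_pos (P.mesh_pos _) _).ne'
  have hm' : P.mesh (j + 1) ^ P.d ≠ 0 := (pow_pos (P.mesh_pos _) _).ne'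
  have hL0 : ((P.L : ℝ) ^ P.d) ≠ 0 := (pow_pos (by exact_mod_cast P.hL) _).ne'
  have hres : resIn (inSet N (blockSet Λ'))
        (B1RT.prec a (P.mesh (j + 1)) P.d • (kerQ C A j *ᵥ fieldCoord (E N) (HiggsLattice.Site P (j + 1)) ψ))
      = (B1RT.prec a (P.mesh (j + 1)) P.d * ((P.L : ℝ) ^ P.d)⁻¹) •
          resIn (inSet N (blockSet Λ')) (fieldCoord (E N) (HiggsLattice.Site P j) (avgQAdjLin C A j ψ)) := by
    rw [kerQ_mulVec, smul_smul]
    rfl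
  have h := siteInner_condCov232_eq_blkIn C Ω A msq a (blockSet Λ') (avgQAdjLin C A j ψ)
  have hkey : resIn (inSet N (blockSet Λ')) (fieldCoord (E N) (HiggsLattice.Site P j) (avgQAdjLin C A j ψ))
        ⬝ᵥ (blkIn (inSet N (blockSet Λ')) (mat (condCov232 C Ω A msq a j (blockSet Λ')))
          *ᵥ resIn (inSet N (blockSet Λ')) (fieldCoord (E N) (HiggsLattice.Site P j) (avgQAdjLin C A j ψ)))
      = (P.mesh j ^ P.d)⁻¹ *
          siteInner (avgQAdjLin C A j ψ) (condCov232 C Ω A msq a j (blockSet Λ') (avgQAdjLin C A j ψ)) := by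
    rw [h, ← mul_assoc, inv_mul_cancel₀ hm, one_mul]
  rw [form227, sum_filter_mem_sq, hres, cov_eq C Ω A j hmsq ha hL hj]
  simp only [Matrix.smul_mulVec, Matrix.mulVec_smul, smul_dotProduct, dotProduct_smul, smul_eq_mul]
  rw [hkey, siteInner_condDelta227, ← stepCoef_mul_mesh_pow, ← mesh_pow_mul_L_pow j]
  field_simp

/-- **Dictionary, second exponent**: p15's `secondExp` (boundary set = all pairs) at the `j`-th step letters, evaluated at
the exterior configuration `y`, IS `stepExp246` at the field `fieldOfOut Λ y` — the five printed terms identified one by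
one (`outSum_eq`, `blkOut_form_eq`, `bdryQuad_eq`, `bdryLin_eq`, `form227_eq`). [cite: Balaban1982Higgs2, (2.46) p.567] -/
theorem secondExp_eq_stepExp246 {msq a : ℝ} (hmsq : 0 < msq) (ha : 0 < a) (hL : 1 < (P.L : ℝ)) (hj : j ≤ P.K)
    (Λ' : Finset (HiggsLattice.Site P (j + 1))) (ψ : ScalarField P (j + 1) N)
    (y : Out (inSet (P := P) N (blockSet Λ')) → ℝ) :
    secondExp (inSet N (blockSet Λ')) (inSet N Λ') (B1RT.prec a (P.mesh (j + 1)) P.d) (kerQ C A j) (matD C A Ω msq a j)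
        Finset.univ (fieldCoord (E N) (HiggsLattice.Site P (j + 1)) ψ) y
      = stepExp246 C Ω A msq a j Λ' ψ (fieldOfOut (blockSet Λ') y) := by
  have hm' : P.mesh (j + 1) ^ P.d ≠ 0 := (pow_pos (P.mesh_pos _) _).ne'
  rw [secondExp, outSum_eq, blkOut_form_eq, bdryQuad_eq C Ω A j hmsq ha hL hj, bdryLin_eq C Ω A j hmsq ha hL hj,
    form227_eq C Ω A j hmsq ha hL hj, stepExp246, outExp, condTerms246, cutTo_compl_fieldOfOut, ← stepCoef_mul_mesh_pow]
  field_simp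
  ring

end Exponents

/-! ## §3 The conditional integration (2.45) → (2.46), scalar factor -/

section Step

variable (C : ChargeData N) (Ω : Finset (HiggsLattice.Site P 0)) (A : HiggsLattice.VecField P 0) (msq a : ℝ)

/-- The integrand of the normalisation factor: `x·((formMat)_Λ x) = ⟨φ, (a(L^{j+1}ε)^{−2}P(A) + Δ^{(j)}(Ω,A))φ⟩` for the
`Λ`-supported field `φ = fieldOfCrd Λ x`. [cite: Balaban1982Higgs2, (2.46) p.567] -/
theorem norm_integrand_eq {j : ℕ} (Λ : Finset (HiggsLattice.Site P j)) (x : In (inSet (P := P) N Λ) → ℝ) :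
    x ⬝ᵥ (blkIn (inSet N Λ) (formMat C Ω A msq a j) *ᵥ x)
      = siteInner (fieldOfCrd Λ x) (precOpA C Ω A msq a j (fieldOfCrd Λ x)) := by
  have h := B2Eq228Conditioning.quadForm_glue (inSet N Λ) (formMat C Ω A msq a j) x 0
  simp only [Matrix.mulVec_zero, dotProduct_zero, zero_dotProduct, add_zero] at h
  rw [← h, ← fieldCoord_fieldOfCrd, fieldCoord_dotProduct_formMat]

/-- **… and `(C^{(j)}_Λ(Ω,A))^{−1}` on the `Λ`-supported fields IS the restricted operator** `(a(L^{j+1}ε)^{−2}P(A) + Δ^{(j)})↾_Λ`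
(I (2.32); `HiggsCondCov232.restrictOp_precOpA_mul_condCov232`): the normalisation integrand is `⟨φ, (precOpA)↾_Λ φ⟩`,
the print's `⟨φ, (C^{(j)}_{Λ₅})^{−1}φ⟩` of (2.46)/(2.52). [cite: Balaban1982Higgs2, (2.52) p.569] -/
theorem norm_integrand_eq_restrictOp {j : ℕ} (Λ : Finset (HiggsLattice.Site P j)) (x : In (inSet (P := P) N Λ) → ℝ) :
    siteInner (fieldOfCrd Λ x) (precOpA C Ω A msq a j (fieldOfCrd Λ x))
      = siteInner (fieldOfCrd Λ x)
          (restrictOp Λ (precOpA C Ω A msq a j : Module.End ℝ (ScalarField P j N)) (fieldOfCrd Λ x)) := by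
  rw [siteInner_restrictOp, cutTo_fieldOfCrd]

/-- **(2.45) → (2.46), THE CONDITIONAL INTEGRATION OF THE `k`-TH STEP, SCALAR-FIELD FACTOR, ON THE CONCRETE CARRIER.**
For m² > 0, a > 0, L > 1, `j ≤ K`, every region `Ω`, external field `A`, coupling `C`, every set `Λ′` of sites of `T^{(j+1)}`
(`Λ = B(Λ′)`), every new field `ψ` and every bounded measurable weight `G` of the exterior field (↤ `ζχχρ′·e^{other terms}`):
`∫dφ G(Λᶜφ) exp(−½a(L^{j+1}ε)^{−2}‖ψ − Q(A)φ‖² − ½⟨φ, Δ^{(j)}(Ω,A)φ⟩)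
 = ∫dφ↾_{Λᶜ} G(φ↾_{Λᶜ}) exp(stepExp246(ψ, φ↾_{Λᶜ})) · ∫dφ↾_Λ exp(−½⟨φ, (a(L^{j+1}ε)^{−2}P(A) + Δ^{(j)})φ⟩)`
— *"calculation of a conditional integral in (2.45) with the conditioning on Λ₅^{(k−1)c}"*; p15's (2.34) model theorem
`B2Eq234SecondRepr.secondRepr` with EVERY hypothesis discharged for the concrete letters (`mainOp_eq_formMat` +
`formMat_posDef`, `kerQ_support`, all pairs as boundary set).  `dφ`, `dφ↾_{Λᶜ}`, `dφ↾_Λ` = Lebesgue measure on the fields of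
`T^{(j)}` resp. on the coordinates outside/inside `Λ` (p34's measure-preserving `fieldCoord`). [cite: Balaban1982Higgs2, (2.46) p.567] -/
theorem condStep246 {msq a : ℝ} (hmsq : 0 < msq) (ha : 0 < a) (hL : 1 < (P.L : ℝ)) {j : ℕ} (hj : j ≤ P.K)
    (Λ' : Finset (HiggsLattice.Site P (j + 1))) {G : ScalarField P j N → ℝ} (hG : Measurable G) {CG : ℝ}
    (hGb : ∀ φ, |G φ| ≤ CG) (ψ : ScalarField P (j + 1) N) :
    ∫ φ : ScalarField P j N, G (cutTo (blockSet Λ')ᶜ φ) * Real.exp (stepExp245 C Ω A msq a j ψ φ)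
      = (∫ y : Out (inSet (P := P) N (blockSet Λ')) → ℝ,
            G (fieldOfOut (blockSet Λ') y) * Real.exp (stepExp246 C Ω A msq a j Λ' ψ (fieldOfOut (blockSet Λ') y)))
        * ∫ x : In (inSet (P := P) N (blockSet Λ')) → ℝ,
            Real.exp (-(1 / 2 : ℝ) * siteInner (fieldOfCrd (blockSet Λ') x) (precOpA C Ω A msq a j (fieldOfCrd (blockSet Λ') x))) := by
  have hA : (mainOp (B1RT.prec a (P.mesh (j + 1)) P.d) (kerQ C A j) (matD C A Ω msq a j)).PosDef := by
    rw [mainOp_eq_formMat]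
    exact formMat_posDef C Ω A hmsq ha hL hj
  have hQ : ∀ s t, kerQ C A j s t ≠ 0 → (inSet N (blockSet Λ') s ↔ inSet N Λ' t) :=
    fun s t h => kerQ_support C A j Λ' s t h
  have hst : ∀ i o, (i, o) ∉ (Finset.univ : Finset (In (inSet (P := P) N (blockSet Λ')) × Out (inSet (P := P) N (blockSet Λ'))))
      → blkMix (inSet N (blockSet Λ')) (matD C A Ω msq a j) i o = 0 := fun i o h => absurd (Finset.mem_univ _) h
  have hG₀ : Measurable (fun y : Out (inSet (P := P) N (blockSet Λ')) → ℝ => G (fieldOfOut (blockSet Λ') y)) :=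
    hG.comp (measurable_fieldOfOut (blockSet Λ'))
  have hG₀b : ∀ y : Out (inSet (P := P) N (blockSet Λ')) → ℝ, |G (fieldOfOut (blockSet Λ') y)| ≤ CG := fun y => hGb _
  have key := B2Eq234SecondRepr.secondRepr (inSet N (blockSet Λ')) (inSet N Λ') (B1RT.prec a (P.mesh (j + 1)) P.d)
    (kerQ C A j) (matD C A Ω msq a j) hA hQ Finset.univ hst hG₀ hG₀b (fieldCoord (E N) (HiggsLattice.Site P (j + 1)) ψ)
  have hLHS : (∫ φ : ScalarField P j N, G (cutTo (blockSet Λ')ᶜ φ) * Real.exp (stepExp245 C Ω A msq a j ψ φ))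
      = ∫ z : HiggsLattice.Site P j × Ix N → ℝ, G (fieldOfOut (blockSet Λ') (resOut (inSet N (blockSet Λ')) z))
          * Real.exp (firstExp (B1RT.prec a (P.mesh (j + 1)) P.d) (kerQ C A j) (matD C A Ω msq a j)
              (fieldCoord (E N) (HiggsLattice.Site P (j + 1)) ψ) z) := by
    rw [integral_comp_fieldCoord (E N) (HiggsLattice.Site P j)]
    refine integral_congr_ae (Filter.Eventually.of_forall fun z => ?_)
    beta_reduce
    rw [← firstExp_eq_stepExp245, LinearEquiv.apply_symm_apply, ← fieldOfOut_resOut, LinearEquiv.apply_symm_apply]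
  rw [hLHS, key]
  congr 1
  · refine integral_congr_ae (Filter.Eventually.of_forall fun y => ?_)
    beta_reduce
    rw [secondExp_eq_stepExp246 C Ω A j hmsq ha hL hj]
  · refine integral_congr_ae (Filter.Eventually.of_forall fun x => ?_)
    beta_reduce
    rw [mainOp_eq_formMat, norm_integrand_eq]

/-- The normalisation factor in closed form: `∫dφ↾_Λ e^{−½⟨φ,(C^{(j)}_Λ)^{−1}φ⟩} = √(2π)^{(number of coordinates in Λ)}/√det((formMat)_Λ)`
(p15's `norm234_eq`; p. 565: *"equal to the factors Z … calculated on the set Λ₅"*). [cite: Balaban1982Higgs2, (2.34) p.565] -/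
theorem norm252_eq {msq a : ℝ} (hmsq : 0 < msq) (ha : 0 < a) (hL : 1 < (P.L : ℝ)) {j : ℕ} (hj : j ≤ P.K)
    (Λ : Finset (HiggsLattice.Site P j)) :
    ∫ x : In (inSet (P := P) N Λ) → ℝ, Real.exp (-(1 / 2 : ℝ) * siteInner (fieldOfCrd Λ x) (precOpA C Ω A msq a j (fieldOfCrd Λ x)))
      = Real.sqrt (2 * Real.pi) ^ Fintype.card (In (inSet (P := P) N Λ))
          / Real.sqrt (blkIn (inSet N Λ) (formMat C Ω A msq a j)).det := by
  rw [← B2Eq234SecondRepr.norm234_eq (inSet N Λ) (formMat C Ω A msq a j) (formMat_posDef C Ω A hmsq ha hL hj)]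
  refine integral_congr_ae (Filter.Eventually.of_forall fun x => ?_)
  beta_reduce
  rw [norm_integrand_eq]

/-- The normalisation factor is positive. [cite: Balaban1982Higgs2, (2.52) p.569] -/
theorem norm252_pos {msq a : ℝ} (hmsq : 0 < msq) (ha : 0 < a) (hL : 1 < (P.L : ℝ)) {j : ℕ} (hj : j ≤ P.K)
    (Λ : Finset (HiggsLattice.Site P j)) :
    0 < ∫ x : In (inSet (P := P) N Λ) → ℝ,
        Real.exp (-(1 / 2 : ℝ) * siteInner (fieldOfCrd Λ x) (precOpA C Ω A msq a j (fieldOfCrd Λ x))) := by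
  rw [norm252_eq C Ω A hmsq ha hL hj]
  have hdet : 0 < (blkIn (inSet N Λ) (formMat C Ω A msq a j)).det := (blkIn_formMat_posDef C Ω A hmsq ha hL hj Λ).det_pos
  exact div_pos (pow_pos (Real.sqrt_pos.mpr (by positivity)) _) (Real.sqrt_pos.mpr hdet)

end Step

/-! ## §4 (2.52) and the RT-kernel form of the conditional step -/

section RT

variable (C : ChargeData N) (Ω : Finset (HiggsLattice.Site P 0)) (A : HiggsLattice.VecField P 0) (msq a : ℝ)

/-- **(2.52)** p. 569 for the concrete objects: `Z^{(j),L^jε}_Λ(Ω, A) = (a(L^{j+1}ε)^{d−2}/2π)^{(N/2)|Λ′|} ∫dφ↾_Λ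
exp(−½⟨φ, (C^{(j),L^jε}_Λ(Ω,A))^{−1}φ⟩)` — verbatim *"Z^{(j),L^jε}_{Λ₅^{(j)}}(B^j(Λ₂^{(j)}), Ã^ε) = (a(L^{j+1}ε)^{d−2}/2π)^{(N/2)|Λ₅^{(j)}|}
∫dφ↾_{Λ₅^{(j)}} exp(−½⟨φ, (C^{(j),L^jε}_{Λ₅^{(j)}}(…))^{−1}φ⟩)"*, with `(C^{(j)}_Λ)^{−1}φ = (precOpA)↾_Λφ` on the `Λ`-supported fields
(`norm_integrand_eq_restrictOp`) and `|Λ₅^{(j)}|` read as the number `|Λ′|` of its `L^{j+1}ε`-lattice points (one factor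
`(a(L^{j+1}ε)^{d−2}/2π)^{N/2}` per block, as in the kernel (2.5) and in I (3.32) whose exponent counts `T₁^{(k)}`; the reading
under which `rt_condStep` is an exact identity). [cite: Balaban1982Higgs2, (2.52) p.569] -/
noncomputable def zCond252 (j : ℕ) (Λ' : Finset (HiggsLattice.Site P (j + 1))) : ℝ :=
  (B1RT.prec a (P.mesh (j + 1)) P.d / (2 * Real.pi)) ^ ((N : ℝ) / 2 * (Λ'.card : ℝ))
    * ∫ x : In (inSet (P := P) N (blockSet Λ')) → ℝ,
        Real.exp (-(1 / 2 : ℝ) * siteInner (fieldOfCrd (blockSet Λ') x) (precOpA C Ω A msq a j (fieldOfCrd (blockSet Λ') x)))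

/-- `Z^{(j)}_Λ(Ω,A) > 0` (m² > 0, a > 0, L > 1, j ≤ K). [cite: Balaban1982Higgs2, (2.52) p.569] -/
theorem zCond252_pos {msq a : ℝ} (hmsq : 0 < msq) (ha : 0 < a) (hL : 1 < (P.L : ℝ)) {j : ℕ} (hj : j ≤ P.K)
    (Λ' : Finset (HiggsLattice.Site P (j + 1))) : 0 < zCond252 C Ω A msq a j Λ' := by
  have hprec : 0 < B1RT.prec a (P.mesh (j + 1)) P.d := B1RT.prec_pos ha (P.mesh_pos _) P.d
  exact mul_pos (Real.rpow_pos_of_pos (by positivity) _) (norm252_pos C Ω A hmsq ha hL hj (blockSet Λ'))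

/-- **`t(Λ₅ᶜ; φ, φ′)` of (2.46)**: the kernel (2.5) of `T^{L^jε}_{a,L,A}` with the product restricted to the blocks outside `Λ′`,
`Π_{y∉Λ′} (a(L^{j+1}ε)^{d−2}/2π)^{N/2} exp(−½a(L^{j+1}ε)^{d−2}|ψ(y) − (Q(A)φ)(y)|²)` (b2b's one-site kernel `B1RT.rtKernel`,
the typer's averages `HiggsAveraging.avgQ`). [cite: Balaban1982Higgs2, (2.46) p.567] -/
noncomputable def rtKernelOut (j : ℕ) (Λ' : Finset (HiggsLattice.Site P (j + 1))) (ψ : ScalarField P (j + 1) N)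
    (φ : ScalarField P j N) : ℝ :=
  ∏ y ∈ Λ'ᶜ, B1RT.rtKernel (B1RT.prec a (P.mesh (j + 1)) P.d) (ψ y - avgQ C A φ y)

/-- A product of one-site kernels over a set of blocks in exponential form:
`Π_{y∈S} t(ψ(y) − (Qφ)(y)) = (κ/2π)^{(N/2)|S|} exp(−½a(L^{j+1}ε)^{−2}⟨S(ψ − Qφ), S(ψ − Qφ)⟩)`. [cite: Balaban1982Higgs1, (2.5) p.608] -/
theorem prod_rtKernel_eq (j : ℕ) (S : Finset (HiggsLattice.Site P (j + 1))) (ψ : ScalarField P (j + 1) N) (φ : ScalarField P j N)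
    {a : ℝ} (ha : 0 < a) :
    ∏ y ∈ S, B1RT.rtKernel (B1RT.prec a (P.mesh (j + 1)) P.d) (ψ y - avgQ C A φ y)
      = (B1RT.prec a (P.mesh (j + 1)) P.d / (2 * Real.pi)) ^ ((N : ℝ) / 2 * (S.card : ℝ))
          * Real.exp (-(1 / 2 : ℝ) * stepCoef P a j
              * siteInner (cutTo S (ψ - avgQLin C A j φ)) (cutTo S (ψ - avgQLin C A j φ))) := by
  have hprec : 0 < B1RT.prec a (P.mesh (j + 1)) P.d := B1RT.prec_pos ha (P.mesh_pos _) P.d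
  have hc : 0 ≤ B1RT.prec a (P.mesh (j + 1)) P.d / (2 * Real.pi) := by positivity
  have hN : (Module.finrank ℝ (E N) : ℝ) = N := by
    rw [finrank_euclideanSpace_fin]
  simp only [B1RT.rtKernel_eq, hN]
  rw [Finset.prod_mul_distrib, Finset.prod_const, ← Real.rpow_natCast, ← Real.rpow_mul hc, ← Real.exp_sum,
    siteInner_cutTo_self]
  congr 1
  apply congrArg Real.exp
  rw [← mul_assoc, mul_assoc (-(1 / 2 : ℝ)) (stepCoef P a j) (P.mesh (j + 1) ^ P.d), stepCoef_mul_mesh_pow, Finset.mul_sum]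
  refine Finset.sum_congr rfl fun y _ => ?_
  rw [Pi.sub_apply, avgQLin_apply]
  ring

/-- The full kernel `t_{a,L,A}(ψ, φ)` (2.5) in exponential form. [cite: Balaban1982Higgs1, (2.5) p.608] -/
theorem rtKernelStep_eq (j : ℕ) (ψ : ScalarField P (j + 1) N) (φ : ScalarField P j N) {a : ℝ} (ha : 0 < a) :
    rtKernelStep C a A ψ φ
      = (B1RT.prec a (P.mesh (j + 1)) P.d / (2 * Real.pi)) ^ ((N : ℝ) / 2 * (Fintype.card (HiggsLattice.Site P (j + 1)) : ℝ))
          * Real.exp (-(1 / 2 : ℝ) * stepCoef P a j * siteInner (ψ - avgQLin C A j φ) (ψ - avgQLin C A j φ)) := by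
  rw [rtKernelStep, B1RT.blockKernel_eq, ← Finset.card_univ, prod_rtKernel_eq C A j Finset.univ ψ φ ha, cutTo_univ]

/-- The restricted kernel in exponential form: `t(Λᶜ; ψ, φ) = (κ/2π)^{(N/2)|Λ′ᶜ|} e^{outExp}` at an exterior field `φ = Λᶜφ`.
[cite: Balaban1982Higgs2, (2.46) p.567] -/
theorem rtKernelOut_eq (j : ℕ) (Λ' : Finset (HiggsLattice.Site P (j + 1))) (ψ : ScalarField P (j + 1) N)
    {φ : ScalarField P j N} (hφ : cutTo (blockSet Λ')ᶜ φ = φ) {a : ℝ} (ha : 0 < a) :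
    rtKernelOut C A a j Λ' ψ φ
      = (B1RT.prec a (P.mesh (j + 1)) P.d / (2 * Real.pi)) ^ ((N : ℝ) / 2 * (Λ'ᶜ.card : ℝ))
          * Real.exp (outExp C A a j Λ' ψ φ) := by
  rw [rtKernelOut, prod_rtKernel_eq C A j Λ'ᶜ ψ φ ha, outExp, hφ]

/-- **(2.45) → (2.46) IN THE KERNEL FORM OF THE PRINT, scalar factor**: for m² > 0, a > 0, L > 1, `j ≤ K`, every `Ω`, `A`,
`C`, `Λ′` (`Λ = B(Λ′)`), `ψ`, and every bounded measurable weight `G`,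
`∫dφ′ t^{L^jε}_{a,L,A}(ψ, φ′) · exp(−½⟨φ′, Δ^{(j),L^jε}(Ω,A)φ′⟩) · G(Λᶜφ′)
 = ∫dφ′↾_{Λᶜ} t(Λᶜ; ψ, φ′) · exp[−½⟨Λᶜφ′, ΔΛᶜφ′⟩ + ½⟨Λᶜφ′, ΔC^{(j)}_ΛΔΛᶜφ′⟩ − a(L^{j+1}ε)^{−2}⟨Λᶜφ′, ΔC^{(j)}_ΛQ^*(A)ψ⟩
   − ½⟨ψ, Δ^{(j+1)}_Λ(Ω,A)ψ⟩] · G(φ′↾_{Λᶜ}) · Z^{(j),L^jε}_Λ(Ω, A)`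
(`rtKernelStep` ↤ `t_{a,L,A}`, `rtKernelOut` ↤ `t(Λ₅ᶜ;·,·)`, `condTerms246` ↤ the printed terms 7–10, `zCond252` ↤ (2.52)).
[cite: Balaban1982Higgs2, (2.46) p.567] -/
theorem rt_condStep {msq a : ℝ} (hmsq : 0 < msq) (ha : 0 < a) (hL : 1 < (P.L : ℝ)) {j : ℕ} (hj : j ≤ P.K)
    (Λ' : Finset (HiggsLattice.Site P (j + 1))) {G : ScalarField P j N → ℝ} (hG : Measurable G) {CG : ℝ}
    (hGb : ∀ φ, |G φ| ≤ CG) (ψ : ScalarField P (j + 1) N) :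
    ∫ φ : ScalarField P j N, rtKernelStep C a A ψ φ
        * (Real.exp (-(1 / 2 : ℝ) * siteInner φ (deltaKA C Ω A msq a j φ)) * G (cutTo (blockSet Λ')ᶜ φ))
      = (∫ y : Out (inSet (P := P) N (blockSet Λ')) → ℝ,
            rtKernelOut C A a j Λ' ψ (fieldOfOut (blockSet Λ') y)
              * (Real.exp (condTerms246 C Ω A msq a j Λ' ψ (fieldOfOut (blockSet Λ') y)) * G (fieldOfOut (blockSet Λ') y)))
        * zCond252 C Ω A msq a j Λ' := by
  set c : ℝ := B1RT.prec a (P.mesh (j + 1)) P.d / (2 * Real.pi) with hc_def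
  have hprec : 0 < B1RT.prec a (P.mesh (j + 1)) P.d := B1RT.prec_pos ha (P.mesh_pos _) P.d
  have hc : 0 < c := by rw [hc_def]; positivity
  have hcard : ((Λ'ᶜ.card : ℕ) : ℝ) + (Λ'.card : ℝ) = (Fintype.card (HiggsLattice.Site P (j + 1)) : ℝ) := by
    rw [Finset.card_compl]
    have hle : Λ'.card ≤ Fintype.card (HiggsLattice.Site P (j + 1)) := Finset.card_le_univ _
    push_cast [Nat.cast_sub hle]
    ring
  -- left side: pull the kernel constant out and use `condStep246`
  have hL1 : (∫ φ : ScalarField P j N, rtKernelStep C a A ψ φ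
        * (Real.exp (-(1 / 2 : ℝ) * siteInner φ (deltaKA C Ω A msq a j φ)) * G (cutTo (blockSet Λ')ᶜ φ)))
      = c ^ ((N : ℝ) / 2 * (Fintype.card (HiggsLattice.Site P (j + 1)) : ℝ))
          * ∫ φ : ScalarField P j N, G (cutTo (blockSet Λ')ᶜ φ) * Real.exp (stepExp245 C Ω A msq a j ψ φ) := by
    rw [← integral_const_mul]
    refine integral_congr_ae (Filter.Eventually.of_forall fun φ => ?_)
    beta_reduce
    rw [rtKernelStep_eq C A j ψ φ ha, exp_stepExp245, ← hc_def]
    ring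
  have hR1 : (∫ y : Out (inSet (P := P) N (blockSet Λ')) → ℝ,
        rtKernelOut C A a j Λ' ψ (fieldOfOut (blockSet Λ') y)
          * (Real.exp (condTerms246 C Ω A msq a j Λ' ψ (fieldOfOut (blockSet Λ') y)) * G (fieldOfOut (blockSet Λ') y)))
      = c ^ ((N : ℝ) / 2 * (Λ'ᶜ.card : ℝ))
          * ∫ y : Out (inSet (P := P) N (blockSet Λ')) → ℝ,
              G (fieldOfOut (blockSet Λ') y) * Real.exp (stepExp246 C Ω A msq a j Λ' ψ (fieldOfOut (blockSet Λ') y)) := by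
    rw [← integral_const_mul]
    refine integral_congr_ae (Filter.Eventually.of_forall fun y => ?_)
    beta_reduce
    rw [rtKernelOut_eq C A j Λ' ψ (cutTo_compl_fieldOfOut (blockSet Λ') y) ha, exp_stepExp246, ← hc_def]
    ring
  rw [hL1, hR1, condStep246 C Ω A hmsq ha hL hj Λ' hG hGb ψ, zCond252, ← hc_def, ← hcard, Real.rpow_def_of_pos hc,
    Real.rpow_def_of_pos hc, Real.rpow_def_of_pos hc, mul_add, mul_add, Real.exp_add]
  ring

end RT

end Literature.MathematicalPhysics.QuantumFieldTheory.Balaban1983to89.B2Eq246ScalarStep
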